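import Summits.Ventures.AbcSig.Rows.XTemplateC2a
import Summits.Ventures.AbcSig.Levels.N163
import Summits.Ventures.AbcSig.Levels.N326
import Summits.Ventures.AbcSig.Levels.N326RB
import Summits.Ventures.AbcSig.Levels.N326M6X
import Summits.Ventures.AbcSig.Levels.N163Q2

/-!
# Venture AbcSig — ROW `C2aL163A6`: `xⁿ + 2^a·163^m·yⁿ = z²`, class `a ge6` (GENERATED by plean/leanrow.py)

S-VARIANT (p-lean g5): identical to `xrow_C2aL163A6` except that the residual pair(s) 326.4 @ 13 — closed in the row of record by the certified prime-ideal SIEVE (no module; citation-backing audit Part C) — are discharged IN THE KERNEL on the re-based presentation `rb_326_<k>` (`Levels/N326RB.lean`, `Recipes/SieveDischarge.lean`) under the COMPUTED hypothesis `hRB_… : ∀ f, Matches f orbit → Matches f rb` instead of being CITED.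
Q-VARIANT (p-lean g6 `gen6/spatch2.py`): same statement shape as `xrow_C2aL163A6S` plus ONE more named CITED hypothesis `(hQ : M.Q2Package)` (`Recipes/Q2Package.lean`: the cell's q = 2 rule at ODD level, allowed traces {±1, ±3}), in exchange for which the residual pair(s) 163.1 @ 11, 163.1 @ 13 — closed in the row of record only by the sieve prime q = 2 (citation-backing audit plean/g5/THETAVERIFY-RECORD.md Part C, class Q2-RULE), previously opaque CITED hypotheses `hX_…` — are discharged IN THE KERNEL (`Levels/N163Q2.lean`: the orbit's eigenvalues including `c₂`, mod-n TreeN certificate against `q2Allowed`) under the COMPUTED hypothesis `hQ2_… : ∀ f, Matches f orbit → Matches f q2`.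
HONEST FRAMING. A row of a COMPUTATION cell (`pub-abcsig`); a CONDITIONAL theorem, no claim on ABC or any summit.
Hypotheses: `BS04Package` (CITED), `DataComplete` at levels [163, 326] (COMPUTED, two-engine certified
level files), `EisPackage` (CITED: [BS04 (3.1), L4.2, Cor 3.1] + [Sturm 1987]) and `Refines` (COMPUTED) for the orbits whose residual exponent is discharged IN THE KERNEL by a module-M6 certificate (`Levels/N…M6X.lean`), and the listed per-orbit exclusions `hX_…` (CITED; the
row's R5 cell names each) that remain. Everything else is kernel-checked (`Rows/XTemplateC2a.lean`, `Levels/N….lean`). Exponent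
range: prime `n ≥ 11`, `n ≠ 163`; `B = 2^a 163^m` with `a, m < n` (n-th-power free).
Row of record:  (sha256 ; SIGNED 2026-08-22T09:50:52Z by referee (ref-g5)); its R0: THEOREM (uses CITED arithmetic facts) for all primes n >= 11 with n coprime to 10432 — class: candidate SHARPENING/new cell (see IK-applicability.md; lit FRESHN. Exponents left open by the row of record are excluded here via ; kernel-sieve residuals the row of record closes by a cell module (M6 Eisenstein / M4 Kraus certificates) appear as CITED hypotheses .
-/

namespace Summit.Ventures.AbcSig

/-- Row `C2aL163A6` (see module docstring). -/
theorem xrow_C2aL163A6Q (M : NewformModel) (hP : M.BS04Package) (hQ : M.Q2Package) (hE : M.EisPackage)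
    (hD163 : M.DataComplete 163 level163Orbits) (hD326 : M.DataComplete 326 level326Orbits)
    (hR_orbit_326_5 : M.Refines 326 orbit_326_5 m6X_326_5)
    (n : ℕ) (hn : n.Prime) (hmin : 11 ≤ n) (hnℓ : n ≠ 163) (a m : ℕ) (ha : 6 ≤ a) (hm : 1 ≤ m) (han : a < n) (hmn : m < n)
    (hQ2_orbit_163_1 : ∀ f : M.Form 163, M.Matches f orbit_163_1 → M.Matches f q2_163_1)
    (hRB_orbit_326_4 : ∀ f : M.Form 326, M.Matches f orbit_326_4 → M.Matches f rb_326_4)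
    (x y z : ℤ) (hxy1 : x * y ≠ 1) (hxy2 : x * y ≠ -1) : ¬ IsPrimitiveSolution 1 (2 ^ a * 163 ^ m) 1 n x y z := by
  have hℓ : Nat.Prime 163 := by norm_num
  have h7 : 7 ≤ n := by omega
  have hS163 :=
    (level163_sieve n hn h7 (fun o => M.Excludes 163 o (famB (2 ^ a * 163 ^ m) n (fun _ _ => True)) ∨ M.ExcludesStd 163 o n) (fun hmem => by
      rcases (by simpa using hmem : n = 7 ∨ n = 11 ∨ n = 13) with rfl | rfl | rfl
      · omega
      · exact Or.inr (orbit_163_1_exclStdQ2_11 M hQ hQ2_orbit_163_1)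
      · exact Or.inr (orbit_163_1_exclStdQ2_13 M hQ hQ2_orbit_163_1)))
  have hS326 :=
    (level326_sieve n hn h7 (fun o => M.Excludes 326 o (famB (2 ^ a * 163 ^ m) n (fun _ _ => True)) ∨ M.ExcludesStd 326 o n) (fun hmem => by
      obtain rfl : n = 7 := by simpa using hmem
      omega) (fun hmem => by
      obtain rfl : n = 7 := by simpa using hmem
      omega) (fun hmem => by
      obtain rfl : n = 7 := by simpa using hmem
      omega) (fun hmem => by
      obtain rfl : n = 13 := by simpa using hmem
      exact Or.inr (orbit_326_4_exclStd_13 M hP hRB_orbit_326_4)) (fun hmem => by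
      obtain rfl : n = 41 := by simpa using hmem
      exact Or.inr (m6c_326_5_n41_excludes M hE hR_orbit_326_5)))
  by_cases ha6 : a = 6
  · subst ha6
    exact xrowC2a_a6 163 hℓ (by norm_num) M hP n hn h7 hnℓ hD163 hD326 m hm hmn
      hS163
      hS326 x y z hxy1 hxy2
  · exact xrowC2a_age7 163 hℓ (by norm_num) M hP n hn h7 hnℓ hD326 a m (by omega) hm han hmn
      hS326 x y z hxy1 hxy2

end Summit.Ventures.AbcSig
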